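import Literature.NumberTheory.Transcendental.AyoubRelativeFiniteRank

/-!
# Ayoub's relative Kontsevich–Zagier theorem revisited — algebraic series involve finitely many
# variables (`𝒪†_alg(𝔸^∞ × 𝔼^∞) = ⋃_{m,n} 𝒪†_alg(𝔸^m × 𝔼^n)`)

Theorems only, on top of `Literature/NumberTheory/Transcendental/AyoubRelative.lean` (objects and
the NAMED FACT `Literature.NumberTheory.Transcendental.AyoubRel.ayoub_relativeKZ_revisited` =
Théorème 1.7 of J. Ayoub, *La version relative de la conjecture des périodes de Kontsevich–Zagier
revisitée*, Tohoku Math. J. (2) 71 (2019) 465–485), `…Algebraicity.lean` and `…FiniteRank.lean`.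

## Why

Notation 1.6 of the note defines, for a smooth affine `k`-scheme `X`, `𝒪†_alg(X)` as the elements
of `𝒪(X)[[ϖ]][ϖ⁻¹]` algebraic over `Frac(𝒪(X))(ϖ)`, and then
`𝒪†_alg(𝔸^∞ × 𝔼^∞) := ⋃_{m,n} 𝒪†_alg(𝔸^m × 𝔼^n)` — a UNION over finitely many variables. The
vendored `Odagger k` instead takes all Laurent series with coefficients in
`𝒪 = k[z₁, z₂, …, t₁^{±1}, …]` (each coefficient a polynomial, but a priori in unboundedly many
variables) annihilated by a non-zero `P ∈ 𝒪[ϖ][Y]`. This file proves that the two agree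
(`exists_finite_variables_of_mem_odagger`): every `F ∈ Odagger k` has ALL its coefficients in
`k[z_S, t_T^{±1}]` for finite sets `S, T` of indices which also contain the variables of an
annihilating polynomial `P` — i.e. `F ∈ 𝒪†_alg(𝔸^S × 𝔼^T)`. (Cf. the note, §1.1: "la condition
d'algébricité entraîne en particulier que les coefficients `f_r` ne dépendent que d'un nombre fini
des `zᵢ` indépendamment de `r`".) So the vendored fact quantifies over exactly Ayoub's space.

## Proof

Take `P ≠ 0` with `P(F) = 0` of minimal degree and let `S, T` collect the (finitely many)
variables occurring in its coefficients. For a variable `zᵢ`, `i ∉ S`, the Euler derivation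
`D = zᵢ∂/∂zᵢ` of `𝒪` kills every coefficient of `P`, so differentiating coefficientwise gives
`0 = D(P(F)) = P'(F) · DF` (`mapCoeff_eq_zero_of_minimal`); `P'(F) ≠ 0` by minimality
(characteristic `0`) and `𝒪((ϖ))` is a domain, so `DF = 0`. As `D` is diagonal on monomials with
eigenvalue the exponent of `zᵢ` (`coeff_apply_of_diagonal`), no coefficient of `F` involves `zᵢ`.
Same with `tⱼ∂/∂tⱼ` for `j ∉ T`.

## References

* J. Ayoub, *La version relative de la conjecture des périodes de Kontsevich–Zagier revisitée*,
  Tohoku Math. J. (2) 71 (2019) 465–485 (doi:10.2748/tmj/1568772181; preprint `rel-KZ-bis.pdf`),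
  §1.1 (p. 2), Notation 1.6, Théorème 1.7 (bib key `AyoubRelKZRevisited`).
-/

noncomputable section

open Polynomial

namespace Literature.NumberTheory.Transcendental.AyoubRel

variable {k : Type} [Field k]

/-! ### 1. Diagonal operators on `𝒪` -/

/-- A `k`-linear operator diagonal on monomials, `D(z^a t^b) = e(a,b) · z^a t^b`, multiplies each
coefficient by its eigenvalue. [folklore] -/
theorem coeff_apply_of_diagonal (D : O k →ₗ[k] O k) (e : Mono → k)
    (hD : ∀ m : Mono, D (mono k m) = e m • mono k m) (f : O k) (m : Mono) :
    (D f).coeff m = e m * f.coeff m := by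
  classical
  induction f using AddMonoidAlgebra.induction_linear with
  | zero => simp
  | add f g hf hg =>
    simp only [map_add, AddMonoidAlgebra.coeff_add, Finsupp.add_apply, hf, hg, mul_add]
  | single μ a =>
    rw [single_eq_smul_mono, map_smul, hD, smul_smul, mono, AddMonoidAlgebra.smul_single,
      AddMonoidAlgebra.smul_single, AddMonoidAlgebra.coeff_single, AddMonoidAlgebra.coeff_single,
      smul_eq_mul, smul_eq_mul, mul_one, mul_one, Finsupp.single_apply, Finsupp.single_apply]
    split_ifs with h
    · subst h; ring
    · ring

/-- A diagonal operator kills `f` iff its eigenvalues vanish on the monomials of `f`. [folklore] -/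
theorem diagonal_apply_eq_zero_iff (D : O k →ₗ[k] O k) (e : Mono → k)
    (hD : ∀ m : Mono, D (mono k m) = e m • mono k m) (f : O k) :
    D f = 0 ↔ ∀ m ∈ f.coeff.support, e m = 0 := by
  constructor
  · intro h m hm
    have h1 := coeff_apply_of_diagonal D e hD f m
    rw [h, AddMonoidAlgebra.coeff_zero, Finsupp.zero_apply] at h1
    rcases mul_eq_zero.mp h1.symm with h2 | h2
    · exact h2
    · exact absurd h2 (Finsupp.mem_support_iff.mp hm)
  · intro h
    apply AddMonoidAlgebra.coeff_injective
    ext m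
    rw [coeff_apply_of_diagonal D e hD, AddMonoidAlgebra.coeff_zero, Finsupp.zero_apply]
    by_cases hm : m ∈ f.coeff.support
    · rw [h m hm, zero_mul]
    · rw [Finsupp.notMem_support_iff.mp hm, mul_zero]

/-! ### 2. Minimal annihilating polynomials and the chain rule -/

/-- An algebraic Laurent series has an annihilating polynomial of minimal degree. [folklore] -/
theorem exists_minimal_of_mem_odagger {F : LaurentSeries (O k)} (hF : F ∈ Odagger k) :
    ∃ P : Polynomial (Polynomial (O k)), P ≠ 0 ∧ aeval F P = 0 ∧
      ∀ Q : Polynomial (Polynomial (O k)), Q ≠ 0 → aeval F Q = 0 → P.natDegree ≤ Q.natDegree := by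
  classical
  have hex : ∃ d : ℕ, ∃ P : Polynomial (Polynomial (O k)),
      P ≠ 0 ∧ aeval F P = 0 ∧ P.natDegree = d := by
    obtain ⟨P, hP0, hPF⟩ := (mem_odagger_iff F).mp hF
    exact ⟨_, P, hP0, hPF, rfl⟩
  obtain ⟨P, hP0, hPF, hPd⟩ := Nat.find_spec hex
  exact ⟨P, hP0, hPF, fun Q hQ0 hQF => hPd ▸ Nat.find_min' hex ⟨Q, hQ0, hQF, rfl⟩⟩

/-- **`DF = 0` when the derivation `D` kills the coefficients of a minimal relation.** For a
`k`-linear derivation `D` of `𝒪` and `P(F) = 0` with `P ≠ 0` of minimal degree, if `D` annihilates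
every coefficient (in `𝒪`) of `P ∈ 𝒪[ϖ][Y]`, then `0 = D(P(F)) = P'(F) · DF` with `P'(F) ≠ 0`
(characteristic `0`), hence `DF = 0` in the domain `𝒪((ϖ))`. [folklore] -/
theorem mapCoeff_eq_zero_of_minimal [CharZero k] (D : O k →ₗ[k] O k)
    (hD : ∀ f g : O k, D (f * g) = D f * g + f * D g) {F : LaurentSeries (O k)}
    {P : Polynomial (Polynomial (O k))} (hP0 : P ≠ 0) (hPF : aeval F P = 0)
    (hmin : ∀ Q : Polynomial (Polynomial (O k)), Q ≠ 0 → aeval F Q = 0 → P.natDegree ≤ Q.natDegree)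
    (hcoef : ∀ a b : ℕ, D ((P.coeff a).coeff b) = 0) : mapCoeff k D F = 0 := by
  classical
  have hinj : Function.Injective (algebraMap (Polynomial (O k)) (LaurentSeries (O k))) :=
    Polynomial.algebraMap_hahnSeries_injective ℤ
  -- `P` has positive degree
  have hd0 : P.natDegree ≠ 0 := by
    intro h0
    apply hP0
    rw [Polynomial.eq_C_of_natDegree_eq_zero h0] at hPF ⊢
    rw [Polynomial.aeval_C] at hPF
    rw [hinj (hPF.trans (map_zero _).symm), map_zero]
  haveI : CharZero (Polynomial (O k)) :=
    charZero_of_injective_algebraMap (FaithfulSMul.algebraMap_injective k (Polynomial (O k)))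
  set d := P.natDegree with hd
  -- its derivative is non-zero, of smaller degree, hence does not kill `F`
  have hP'deg : (derivative P).natDegree < d := Polynomial.natDegree_derivative_lt hd0
  have hP'0 : derivative P ≠ 0 := by
    intro h
    have hc := Polynomial.coeff_derivative P (d - 1)
    rw [h, Polynomial.coeff_zero, Nat.sub_add_cancel (Nat.pos_of_ne_zero hd0)] at hc
    have h1 : ((d - 1 : ℕ) : Polynomial (O k)) + 1 = (d : Polynomial (O k)) := by
      rw [← Nat.cast_succ]; congr 1; omega
    rw [h1] at hc
    have : P.coeff d = 0 := by
      rcases mul_eq_zero.mp hc.symm with h2 | h2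
      · exact h2
      · exact absurd h2 (Nat.cast_ne_zero.mpr hd0)
    exact hP0 (Polynomial.leadingCoeff_eq_zero.mp this)
  have hP'F : aeval F (derivative P) ≠ 0 := fun h =>
    absurd (hmin _ hP'0 h) (not_le.mpr hP'deg)
  -- `D` kills the images of the coefficients of `P`
  have hDcoef : ∀ a : ℕ,
      mapCoeff k D (algebraMap (Polynomial (O k)) (LaurentSeries (O k)) (P.coeff a)) = 0 := by
    intro a
    rw [mapCoeff_algebraMap]
    simp only [hcoef, map_zero, zero_mul, Finset.sum_const_zero]
  -- the chain rule `D(P(F)) = P^D(F) + P'(F) · DF = P'(F) · DF`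
  have hchain : mapCoeff k D (aeval F P) = aeval F (derivative P) * mapCoeff k D F := by
    rw [Polynomial.aeval_eq_sum_range, map_sum]
    simp_rw [Algebra.smul_def, mapCoeff_mul_of_leibniz D hD, hDcoef, zero_mul, zero_add]
    rw [Finset.sum_range_succ', pow_zero, mapCoeff_one_of_leibniz D hD, mul_zero, add_zero]
    simp_rw [mapCoeff_pow_of_leibniz D hD]
    rw [Polynomial.aeval_eq_sum_range' hP'deg, Finset.sum_mul]
    refine Finset.sum_congr rfl fun j _ => ?_
    rw [Polynomial.coeff_derivative, Algebra.smul_def, map_mul, map_add, map_natCast, map_one]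
    ring
  have h0 : aeval F (derivative P) * mapCoeff k D F = 0 := by rw [← hchain, hPF, map_zero]
  rcases mul_eq_zero.mp h0 with h1 | h1
  · exact absurd h1 hP'F
  · exact h1

/-- **A diagonal derivation whose eigenvalues vanish on the monomials of a minimal relation of `F`
has vanishing eigenvalues on the monomials of every coefficient of `F`.** [folklore] -/
theorem eigenvalue_eq_zero_of_minimal [CharZero k] (D : O k →ₗ[k] O k) (e : Mono → k)
    (hD : ∀ f g : O k, D (f * g) = D f * g + f * D g) (hDe : ∀ m : Mono, D (mono k m) = e m • mono k m)
    {F : LaurentSeries (O k)} {P : Polynomial (Polynomial (O k))} (hP0 : P ≠ 0) (hPF : aeval F P = 0)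
    (hmin : ∀ Q : Polynomial (Polynomial (O k)), Q ≠ 0 → aeval F Q = 0 → P.natDegree ≤ Q.natDegree)
    (hkill : ∀ a b : ℕ, ∀ m ∈ ((P.coeff a).coeff b).coeff.support, e m = 0) (n : ℤ) :
    ∀ m ∈ (F.coeff n).coeff.support, e m = 0 := by
  have hDF := mapCoeff_eq_zero_of_minimal D hD hP0 hPF hmin
    (fun a b => (diagonal_apply_eq_zero_iff D e hDe _).mpr (hkill a b))
  have hn : D (F.coeff n) = 0 := by
    have := congrArg (fun G : LaurentSeries (O k) => G.coeff n) hDF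
    simpa only [mapCoeff_coeff, HahnSeries.coeff_zero] using this
  exact (diagonal_apply_eq_zero_iff D e hDe _).mp hn

/-! ### 3. Algebraic Laurent series live in finitely many variables -/

/-- **`𝒪†_alg(𝔸^∞ × 𝔼^∞) = ⋃_{S,T finite} 𝒪†_alg(𝔸^S × 𝔼^T)`** (Notation 1.6 as a union, for the
vendored `Odagger`): for `F ∈ 𝒪†_alg` there are finite sets `S, T` of indices and a non-zero
annihilating polynomial `P ∈ 𝒪[ϖ][Y]` of `F` such that every monomial `z^a t^b` occurring in a
coefficient of `P` OR in a coefficient of `F` has `supp a ⊆ S` and `supp b ⊆ T` — i.e. `F` and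
`P` are defined over `k[z_S, t_T^{±1}]`, so `F ∈ 𝒪†_alg(𝔸^S × 𝔼^T)`.
[Ayoub, revisited note, Notation 1.6 and §1.1 p. 2] [cite: AyoubRelKZRevisited, Notation 1.6] -/
theorem exists_finite_variables_of_mem_odagger [CharZero k] {F : LaurentSeries (O k)}
    (hF : F ∈ Odagger k) :
    ∃ (S T : Finset ℕ) (P : Polynomial (Polynomial (O k))), P ≠ 0 ∧ aeval F P = 0 ∧
      (∀ a b : ℕ, ∀ m ∈ ((P.coeff a).coeff b).coeff.support, m.1.support ⊆ S ∧ m.2.support ⊆ T) ∧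
      ∀ n : ℤ, ∀ m ∈ (F.coeff n).coeff.support, m.1.support ⊆ S ∧ m.2.support ⊆ T := by
  classical
  obtain ⟨P, hP0, hPF, hmin⟩ := exists_minimal_of_mem_odagger hF
  -- the monomials occurring in the coefficients of `P`, and their variables
  set M : Finset Mono := P.support.biUnion fun a =>
    (P.coeff a).support.biUnion fun b => ((P.coeff a).coeff b).coeff.support with hM
  have hPM : ∀ a b : ℕ, ∀ m ∈ ((P.coeff a).coeff b).coeff.support, m ∈ M := by
    intro a b m hm
    have ha : a ∈ P.support := by
      rw [Polynomial.mem_support_iff]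
      intro h0
      rw [h0, Polynomial.coeff_zero, AddMonoidAlgebra.coeff_zero] at hm
      simp at hm
    have hb : b ∈ (P.coeff a).support := by
      rw [Polynomial.mem_support_iff]
      intro h0
      rw [h0, AddMonoidAlgebra.coeff_zero] at hm
      simp at hm
    exact Finset.mem_biUnion.mpr ⟨a, ha, Finset.mem_biUnion.mpr ⟨b, hb, hm⟩⟩
  refine ⟨M.biUnion fun m => m.1.support, M.biUnion fun m => m.2.support, P, hP0, hPF,
    fun a b m hm => ⟨Finset.subset_biUnion_of_mem (fun m : Mono => m.1.support) (hPM a b m hm),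
      Finset.subset_biUnion_of_mem (fun m : Mono => m.2.support) (hPM a b m hm)⟩, fun n m hm => ?_⟩
  constructor
  · -- a variable `zᵢ` outside `S`: use the Euler derivation `zᵢ ∂/∂zᵢ`
    intro i hi
    by_contra hiS
    have hkill : ∀ a b : ℕ, ∀ m' ∈ ((P.coeff a).coeff b).coeff.support, ((m'.1 i : ℕ) : k) = 0 := by
      intro a b m' hm'
      rw [Nat.cast_eq_zero, ← Finsupp.notMem_support_iff]
      exact fun h => hiS (Finset.mem_biUnion.mpr ⟨m', hPM a b m' hm', h⟩)
    have h := eigenvalue_eq_zero_of_minimal _ (fun m : Mono => ((m.1 i : ℕ) : k)) (zEuler_mul i)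
      (zEuler_mono i) hP0 hPF hmin hkill n m hm
    exact Finsupp.mem_support_iff.mp hi (Nat.cast_eq_zero.mp h)
  · -- a variable `tⱼ` outside `T`: use the Euler derivation `tⱼ ∂/∂tⱼ`
    intro j hj
    by_contra hjT
    have hkill : ∀ a b : ℕ, ∀ m' ∈ ((P.coeff a).coeff b).coeff.support, ((m'.2 j : ℤ) : k) = 0 := by
      intro a b m' hm'
      rw [Int.cast_eq_zero, ← Finsupp.notMem_support_iff]
      exact fun h => hjT (Finset.mem_biUnion.mpr ⟨m', hPM a b m' hm', h⟩)
    have h := eigenvalue_eq_zero_of_minimal _ (fun m : Mono => ((m.2 j : ℤ) : k)) (euler_mul j)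
      (euler_mono j) hP0 hPF hmin hkill n m hm
    exact Finsupp.mem_support_iff.mp hj (Int.cast_eq_zero.mp h)

/-- In particular (the statement of §1.1, p. 2, for `𝒪†_alg`): **the coefficients of an algebraic
Laurent series involve only finitely many of the variables `zᵢ, tⱼ`, uniformly in the degree.**
[Ayoub, revisited note, §1.1 p. 2 / Notation 1.6] [cite: AyoubRelKZRevisited, Notation 1.6] -/
theorem exists_finset_supp_subset_of_mem_odagger [CharZero k] {F : LaurentSeries (O k)}
    (hF : F ∈ Odagger k) :
    ∃ S T : Finset ℕ, ∀ n : ℤ, ∀ m ∈ (F.coeff n).coeff.support, m.1.support ⊆ S ∧ m.2.support ⊆ T := by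
  obtain ⟨S, T, -, -, -, -, h⟩ := exists_finite_variables_of_mem_odagger hF
  exact ⟨S, T, h⟩

end Literature.NumberTheory.Transcendental.AyoubRel
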